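import Summits.NavierStokesRegularity.TurbBounds.Certs.N1prime.EvalRule
import Summits.NavierStokesRegularity.TurbBounds.Certs.N1prime.B014
import Literature.Computation.Certificates.Blocks
import HarnessLib

/-!
# Row N1prime evaluator — BLOCK IDENTITY 14/59: `B014.A = den • Mel ε u v` (block 14, tan-left on [11585/1024, 13777/1024])
(cell `pub-turb` / `turb-bounds`, v2 item RB-N1′-in-Lean per HOME/pub-turb-cert/RB-LEAN-V2-DESIGN.md §1; producer of THIS FILE pub-turb-cert = prover-pub-turb-cert-g7-0 (t12_evaluator_rb.py, the P > 0 extension of pub-turb-sos's t12_evaluator.py); row and source container by pub-turb-cert: `HOME/pub-turb-cert/certs/N1prime-canary-ra1e4-allk/rbcert.json`, rbcert/0, sha256 `5daad8d71401bf8a…`; CERTIFIED.md row RB-N1′: Ra = 10000, ALL horizontal periods / lattices, `Nu ≤ 871753553815459157/273640575184404480` (outward decimal 3.1857613).)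

HONEST FRAMING: rigorous bounds for the stated PDE and boundary conditions; no claim about physical turbulence beyond the bound.
FILE LAYOUT of the row-N1prime evaluator (one namespace `Summit.NavierStokesRegularity.TurbBounds.Certs.N1prime.Evaluator` reopened across the files, every file ≤ 400 lines; the layout of the tree's `Certs/N0` (lemma R-I′ rows) and `Certs/P2R4` (per-interval COVER files) evaluators): `EvalData1…7.lean` (§1–2: constants and the 14 piece matrices — DATA) → `EvalRule.lean` (§3: the rule `Mel`, its pencil forms, the real pencil `MelR` and the block-to-pencil transfer) → `EvalGramB.lean` + `EvalGrams.lean` (§4: `Bcoef ⪰ 0` by a streaming integer Gram certificate, `Acoef ⪰ 0` diagonal, `TT ⪰ 0` Gram) → `EvalBlock01…59.lean` (§5: one file per block, the evaluator identity `eval_j : B0jj.A = den_j • Mel ε_j u_j v_j` against the landed block module, via the LIST identity `B0jj.A_rows = EvalRows.lincomb (psOf …)` — `TurbBounds/EvalRows.lean`) → `Cover01…Cover30.lean` (§6: per cover interval, the interval theorem `interval_i`) → `Evaluator.lean` (§8: **`certificate`**; `cutoff` is in EvalData1 — the full statement of what is and is NOT kernel-checked is in THAT file's header); generic interval lemmas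 in `TurbBounds/IntervalLemma.lean` + `IntervalLemmaR.lean` (in the tree).
-/

set_option linter.style.longLine false
set_option linter.style.setOption false
set_option linter.unusedSimpArgs false
set_option maxRecDepth 100000

namespace Summit.NavierStokesRegularity.TurbBounds.Certs.N1prime.Evaluator

open Literature.Computation.Certificates Matrix

/-! ## 5. Evaluator identity of block 14 -/

/-- block 14 (tan-left on [11585/1024, 13777/1024]): datum `u = 16352256/189805729` (= KINV2). -/
def u14 : ℚ := ((16352256 : ℚ) / 189805729)
/-- block 14: datum `v` (= K2, lower bound for `K` on the block's range; `0` for the bottom block). -/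
def v14 : ℚ := ((11585 : ℚ) / 1024)
/-- block 14: Young weight `ε` (rbsdp SPEC 3.6 rule at this block's `u`, rounded, as stored in the container). -/
def ε14 : ℚ := ((27799 : ℚ) / 200000)
/-- block 14: the positive integer denominator cleared by the certificate container (`Cn = den·M`). -/
def den14 : ℚ := (3968992561891625187587424934948641660706371495359758281599877120000000 : ℚ)
/-- `0 < den`. -/
theorem den14_pos : 0 < den14 := by norm_num [den14]
set_option maxHeartbeats 0 in
/-- evaluator identity at the LIST level: the block's rows ARE the assembled rows of `den • Mel ε14 u14 v14` (kernel `decide`, one pass per piece — `TurbBounds/EvalRows.lean`). -/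
theorem eval14_rows : B014.A_rows = EvalRows.lincomb 62 (psOf den14 ε14 u14 v14) := by
  decide +kernel
/-- **Evaluator identity for block 14**: the certified block IS the rule at its data. -/
theorem eval14 : B014.A = den14 • Mel ε14 u14 v14 := eval_of_rows eval14_rows

end Summit.NavierStokesRegularity.TurbBounds.Certs.N1prime.Evaluator
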